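import Mathlib.RingTheory.Flat.Basic
import Mathlib.LinearAlgebra.TensorProduct.Prod
import HarnessLib

/-!
# The product of two flat modules is flat

Mathlib (pin v4.32) has `Module.Flat.directSum` / `Module.Flat.dfinsupp` (arbitrary direct sums of
flat modules are flat) but no statement for the binary product `M × N`; where needed it transports
flatness to a particular product by hand (e.g. `Mathlib/RingTheory/Ideal/Pure.lean`). This file
proves the binary case directly: `Literature.RingTheory.Flat.flat_prod` — for `f : X → Y`
injective, `f ⊗ (M × N)` is `(f ⊗ M) × (f ⊗ N)` under `X ⊗ (M × N) ≅ (X ⊗ M) × (X ⊗ N)` (Mathlib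
`TensorProduct.prodRight`), hence injective. It is used for the terms `Kⁿ⁺¹ ⊕ Lⁿ` of the mapping
cone of a morphism of complexes of flat modules
(`Literature/Algebra/Homology/FlatQuasiIsoBaseChange`). Stated as a theorem, not an instance
(CONVENTIONS §4). Mathlib searched (pin): `Module.Flat.directSum`, `Module.Flat.of_linearEquiv`,
`Module.Flat.iff_rTensor_preserves_injective_linearMap`, `TensorProduct.prodRight` (used).

## References

* The Stacks Project, Section 10.39 (Algebra, flat modules; Lemma 10.39.5, Tag 00HD:
  characterisation of flatness by injectivity of `− ⊗ M` on injections). [StacksProject]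
* H. Matsumura, *Commutative Ring Theory* (1986/1989), §7 (a direct sum is flat iff each summand
  is). [Matsumura1987]
-/

universe u v v' w

open TensorProduct

namespace Literature.RingTheory.Flat

/-- **A product of two flat modules is flat**: if `M` and `N` are flat over the commutative ring
`R` then so is `M × N` — for `f : X → Y` injective, `f ⊗ (M × N) ≅ (f ⊗ M) × (f ⊗ N)` is
injective. [folklore] -/
theorem flat_prod {R : Type u} [CommRing R] (M : Type v) (N : Type v') [AddCommGroup M]
    [Module R M] [AddCommGroup N] [Module R N] [Module.Flat R M] [Module.Flat R N] :
    Module.Flat R (M × N) := by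
  rw [Module.Flat.iff_rTensor_preserves_injective_linearMap]
  intro X Y _ _ _ _ f hf
  have key : ∀ z : X ⊗[R] (M × N),
      TensorProduct.prodRight R R Y M N (f.rTensor (M × N) z) =
        LinearMap.prodMap (f.rTensor M) (f.rTensor N) (TensorProduct.prodRight R R X M N z) := by
    intro z
    induction z using TensorProduct.induction_on with
    | zero => simp [Prod.zero_eq_mk]
    | tmul x p => simp
    | add x y hx hy => simp only [map_add, hx, hy]
  intro a b hab
  have h := congr_arg (TensorProduct.prodRight R R Y M N) hab
  rw [key, key] at h
  have hinj : Function.Injective (LinearMap.prodMap (f.rTensor M) (f.rTensor N)) := by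
    rw [LinearMap.coe_prodMap]
    exact (Module.Flat.rTensor_preserves_injective_linearMap f hf).prodMap
      (Module.Flat.rTensor_preserves_injective_linearMap f hf)
  exact (TensorProduct.prodRight R R X M N).injective (hinj h)

end Literature.RingTheory.Flat
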